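import Literature.Analysis.Complex.CahenMellinDirichlet
import Literature.Analysis.Complex.RademacherPhragmenLindelof
import Mathlib.Analysis.MeanInequalities
import HarnessLib

/-!
# Shifting the line in a Mellin–Barnes integral `∫ Φ(s) Γ(s) w^{−s} ds` past the poles of `Γ`

Topic `Literature/Analysis/Complex` (contour integration), continuing `CahenMellinDirichlet.lean`.
Everything here is PROVED; there are no named facts and no definitions.

For an ENTIRE function `Φ` of finite order in the strip `−k − 1/2 ≤ re s ≤ 3/2`, polynomially
bounded on the left edge and bounded on the right edge, and `w > 0`,

  `(1/2π) ∫ Φ Γ w^{−s} |_{re s = 3/2} − (1/2π) ∫ Φ Γ w^{−s} |_{re s = −k−1/2}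
      = ∑_{j ≤ k} (−1)^j Φ(−j) wʲ / j!`                         (`mellinBarnes_shift_eq_sum`)

i.e. `(1/2πi)(∫_{(3/2)} − ∫_{(−k−1/2)}) Φ(s)Γ(s)w^{−s} ds = Σ_{j ≤ k} Res_{s=−j}`, the residues of
`Γ` at `−j` being `(−1)^j/j!`. This is the standard step in Cahen–Mellin ("Hardy–Littlewood /
Landau") treatments of `∑ b(n) e^{−nw}` for a Dirichlet series `Φ(s) = ∑ b(n)n^{−s}` with analytic
continuation (Titchmarsh, *The Theory of the Riemann Zeta-Function*, §2.7 and §9.?; for `ζ` the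
case `k → ∞` yields `1/(e^w − 1) = ∑ ζ(−j)(−w)^j/j! + 1/w`).

Ingredients: the residue theorem for a vertical strip
(`Literature.Analysis.Complex.integral_vertical_sub_eq_sum_of_simplePoles`), the simple poles of
`Γ` (`Γ(z) = Γ(z+j+1)/∏_{i≤j}(z+i)` near `−j`), the uniform bound
`‖Γ(x + iT)‖ ≤ 16π²(1+|T|)^{3/2}e^{−π|T|/2}` for `x ≤ 2`, `|T| ≥ 1`
(`norm_Gamma_le_of_re_le_two`), and Rademacher's explicit Phragmén–Lindelöf theorem
(`Literature.Analysis.Complex.rademacher_phragmenLindelof_of_finiteOrder`) to bound `Φ` inside the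
strip, so that the horizontal cross-sections tend to `0`.

## References

* E. C. Titchmarsh, *The Theory of the Riemann Zeta-Function*, 2nd ed. (1986), §2.7.
* H. Rademacher, *Topics in Analytic Number Theory* (1973), Ch. 4 (Phragmén–Lindelöf).
-/

noncomputable section

open _root_.Complex Set MeasureTheory Filter intervalIntegral Real
open scoped _root_.Topology

namespace Literature.Analysis.Complex

open Literature.Analysis.SpecialFunctions

/-! ### The simple poles of `Γ` -/

/-- `∏_{i<j} (−j + i) = (−1)^j j!`. [folklore] -/
theorem prod_range_neg_nat_add (j : ℕ) :
    ∏ i ∈ Finset.range j, (-(j : ℂ) + i) = (-1) ^ j * j.factorial := by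
  rw [← Finset.prod_range_reflect, ← Finset.prod_range_add_one_eq_factorial, Nat.cast_prod,
    Finset.pow_eq_prod_const, ← Finset.prod_mul_distrib]
  refine Finset.prod_congr rfl fun i hi ↦ ?_
  have hi' : i < j := Finset.mem_range.1 hi
  rw [show j - 1 - i = j - (i + 1) from by omega, Nat.cast_sub (by omega : i + 1 ≤ j)]
  push_cast
  ring

/-- The denominator `∏_{i<j} (z + i)` does not vanish on `ball (−j) (1/2)`. [folklore] -/
theorem prod_range_add_nat_ne_zero {j : ℕ} {z : ℂ} (hz : z ∈ Metric.ball (-(j : ℂ)) (1 / 2)) :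
    ∏ i ∈ Finset.range j, (z + i) ≠ 0 := by
  rw [Metric.mem_ball, dist_eq_norm] at hz
  refine Finset.prod_ne_zero_iff.2 fun i hi h0 ↦ ?_
  have hi' : i < j := Finset.mem_range.1 hi
  have hz' : z = -(i : ℂ) := by linear_combination h0
  rw [hz'] at hz
  have : (1 : ℝ) ≤ ‖(-(i : ℂ)) - -(j : ℂ)‖ := by
    rw [show (-(i : ℂ)) - -(j : ℂ) = ((j - i : ℕ) : ℂ) by push_cast [hi'.le]; ring, Complex.norm_natCast]
    exact_mod_cast (by omega : 1 ≤ j - i)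
  linarith

/-- Near `−j` the function `Γ(z+j+1)/∏_{i<j}(z+i)` is holomorphic: the denominator does not
vanish on `ball (−j) (1/2)` and `re (z + j + 1) > 0` there. [folklore] -/
theorem differentiableOn_Gamma_add_div_prod (j : ℕ) :
    DifferentiableOn ℂ
      (fun z : ℂ ↦ Complex.Gamma (z + ((j + 1 : ℕ) : ℂ)) / ∏ i ∈ Finset.range j, (z + i))
      (Metric.ball (-(j : ℂ)) (1 / 2)) := by
  intro z hz
  have hz' := hz
  rw [Metric.mem_ball, dist_eq_norm] at hz'
  have hre : -(1 / 2 : ℝ) < (z + j).re := by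
    have h1 : |(z - -(j : ℂ)).re| ≤ ‖z - -(j : ℂ)‖ := Complex.abs_re_le_norm _
    have h2 : (z - -(j : ℂ)).re = (z + j).re := by simp
    rw [h2] at h1
    linarith [neg_abs_le (z + ↑j).re]
  refine DifferentiableAt.differentiableWithinAt (DifferentiableAt.div ?_ ?_ ?_)
  · refine (Complex.differentiableAt_Gamma _ fun m h ↦ ?_).comp z (differentiableAt_id.add_const _)
    have := congrArg Complex.re h
    simp at this hre
    linarith [(m.cast_nonneg : (0 : ℝ) ≤ m)]
  · have hP : Differentiable ℂ (fun z : ℂ ↦ ∏ i ∈ Finset.range j, (z + (i : ℂ))) :=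
      Differentiable.fun_finsetProd fun i _ ↦ differentiable_id.add_const (i : ℂ)
    exact hP z
  · exact prod_range_add_nat_ne_zero hz

/-- The value at `−j`: `Γ(−j + j + 1)/∏_{i<j}(−j + i) = (−1)^j/j!`. [folklore] -/
theorem Gamma_add_div_prod_neg_nat (j : ℕ) :
    Complex.Gamma (-(j : ℂ) + ((j + 1 : ℕ) : ℂ)) / ∏ i ∈ Finset.range j, (-(j : ℂ) + i) =
      (-1) ^ j / j.factorial := by
  rw [prod_range_neg_nat_add, show (-(j : ℂ)) + ((j + 1 : ℕ) : ℂ) = 1 by push_cast; ring,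
    Complex.Gamma_one]
  have hj : (j.factorial : ℂ) ≠ 0 := by exact_mod_cast j.factorial_ne_zero
  have h1 : ((-1 : ℂ) ^ j) ≠ 0 := pow_ne_zero _ (by norm_num)
  field_simp
  rw [← pow_mul, mul_comm, pow_mul]
  norm_num

/-- **The simple pole of `Γ` at `−j` in concrete form**: for all `z`,
`Γ(z) = (Γ(z+j+1)/∏_{i<j}(z+i)) / (z + j)` (from `Γ(z)⁻¹ = ∏_{i≤j}(z+i) Γ(z+j+1)⁻¹`; both sides
vanish at the poles `z = 0, −1, …, −j` of `Γ`, where Mathlib's `Γ` is `0`). [folklore] -/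
theorem Gamma_eq_div_div (j : ℕ) (z : ℂ) :
    Complex.Gamma z =
      Complex.Gamma (z + ((j + 1 : ℕ) : ℂ)) / (∏ i ∈ Finset.range j, (z + i)) / (z + j) := by
  have h := inv_Gamma_eq_prod_mul_inv_Gamma_add_nat z (j + 1)
  have h2 : Complex.Gamma z = ((Complex.Gamma z)⁻¹)⁻¹ := (inv_inv _).symm
  rw [h2, h, mul_inv, inv_inv, Finset.prod_range_succ, div_div]
  ring

/-! ### A uniform bound for `Γ` on horizontal segments -/

/-- **`‖Γ(x + iT)‖ ≤ 16π² (1+|T|)^{3/2} e^{−π|T|/2}` for every real `x ≤ 2` and `|T| ≥ 1`**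
(shift the real part into `[1, 2]` with `Γ(z) = Γ(z+n)/∏_{i<n}(z+i)` and `‖z + i‖ ≥ |T| ≥ 1`).
[folklore] -/
theorem norm_Gamma_le_of_re_le_two {x T : ℝ} (hx : x ≤ 2) (hT : 1 ≤ |T|) :
    ‖Complex.Gamma (x + T * I)‖ ≤
      16 * π ^ 2 * (1 + |T|) ^ (3 / 2 : ℝ) * Real.exp (-(π * |T|) / 2) := by
  set n : ℕ := ⌈1 - x⌉₊ with hn
  have hx1 : 1 ≤ x + n := by have := Nat.le_ceil (1 - x); linarith
  have hx2 : x + n ≤ 2 := by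
    rcases le_or_gt 1 x with h | h
    · have : n = 0 := by rw [hn]; exact Nat.ceil_eq_zero.2 (by linarith)
      rw [this]; simpa using hx
    · have := Nat.ceil_lt_add_one (by linarith : (0 : ℝ) ≤ 1 - x); linarith
  set z : ℂ := (x : ℂ) + T * I with hz
  have hid := inv_Gamma_eq_prod_mul_inv_Gamma_add_nat z n
  have hzn : z + n = ((x + n : ℝ) : ℂ) + T * I := by rw [hz]; push_cast; ring
  -- `‖∏ (z + i)‖ ≥ 1`
  have hprod : 1 ≤ ‖∏ i ∈ Finset.range n, (z + i)‖ := by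
    rw [norm_prod]
    calc (1 : ℝ) = ∏ _i ∈ Finset.range n, (1 : ℝ) := by simp
      _ ≤ ∏ i ∈ Finset.range n, ‖z + i‖ := Finset.prod_le_prod (fun _ _ ↦ zero_le_one) fun i _ ↦ by
          calc (1 : ℝ) ≤ |T| := hT
            _ = |(z + i).im| := by simp [hz]
            _ ≤ ‖z + i‖ := Complex.abs_im_le_norm _
  have hΓn := norm_Gamma_le_of_mem_Icc hx1 hx2 T
  rw [← hzn] at hΓn
  -- `Γ z = Γ(z+n)/∏`
  have heq : Complex.Gamma z = Complex.Gamma (z + n) / ∏ i ∈ Finset.range n, (z + i) := by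
    have h2 : Complex.Gamma z = ((Complex.Gamma z)⁻¹)⁻¹ := (inv_inv _).symm
    rw [h2, hid, mul_inv, inv_inv, div_eq_mul_inv, mul_comm]
  rw [heq, norm_div]
  calc ‖Complex.Gamma (z + ↑n)‖ / ‖∏ i ∈ Finset.range n, (z + ↑i)‖ ≤ ‖Complex.Gamma (z + ↑n)‖ :=
        div_le_self (norm_nonneg _) hprod
    _ ≤ _ := hΓn

/-! ### Phragmén–Lindelöf in the form used here -/

/-- `x^θ y^{1−θ} ≤ x + y` for `x, y ≥ 0`, `0 ≤ θ ≤ 1`. [folklore] -/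
theorem rpow_mul_rpow_le_add {x y θ : ℝ} (hx : 0 ≤ x) (hy : 0 ≤ y) (h0 : 0 ≤ θ) (h1 : θ ≤ 1) :
    x ^ θ * y ^ (1 - θ) ≤ x + y := by
  have h := Real.geom_mean_le_arith_mean2_weighted (w₁ := θ) (w₂ := 1 - θ) (p₁ := x) (p₂ := y)
    h0 (by linarith) hx hy (by ring)
  nlinarith [mul_nonneg h0 hx, mul_nonneg (by linarith : 0 ≤ 1 - θ) hy]

/-- **Polynomial growth inside a strip from the edges** (Rademacher's Phragmén–Lindelöf theorem,
`Literature.Analysis.Complex.rademacher_phragmenLindelof_of_finiteOrder`, with right exponent `0` and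
the interpolated bound weakened to a sum): if `Φ` is entire of finite order
`‖Φ(z)‖ ≤ C e^{|im z|^c}` in `a < re z < b`, `‖Φ‖ ≤ A‖Q + z‖^α` on `re z = a` and `‖Φ‖ ≤ B` on
`re z = b` (`Q + a > 0`, `A, B > 0`, `α ≥ 0`), then `‖Φ(z)‖ ≤ A‖Q+z‖^α + B` throughout
`a ≤ re z ≤ b`. [folklore] -/
theorem norm_le_of_edge_bounds {Φ : ℂ → ℂ} (hΦ : Differentiable ℂ Φ) {a b Q A B α C c : ℝ}
    (hab : a < b) (hQ : 0 < Q + a) (hA : 0 < A) (hB : 0 < B) (hα : 0 ≤ α) (hc : 0 < c)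
    (hgr : ∀ z : ℂ, a < z.re → z.re < b → ‖Φ z‖ ≤ C * Real.exp (|z.im| ^ c))
    (ha : ∀ z : ℂ, z.re = a → ‖Φ z‖ ≤ A * ‖(Q : ℂ) + z‖ ^ α)
    (hb : ∀ z : ℂ, z.re = b → ‖Φ z‖ ≤ B)
    {z : ℂ} (hza : a ≤ z.re) (hzb : z.re ≤ b) :
    ‖Φ z‖ ≤ A * ‖(Q : ℂ) + z‖ ^ α + B := by
  have h := rademacher_phragmenLindelof_of_finiteOrder (f := Φ) (β := 0) hab hQ hA hB hα
    hΦ.diffContOnCl hc hgr ha (fun z hz ↦ by rw [Real.rpow_zero, mul_one]; exact hb z hz) hza hzb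
  rw [Real.rpow_zero, mul_one] at h
  have hba : 0 < b - a := sub_pos.2 hab
  set θ : ℝ := (b - z.re) / (b - a) with hθ
  have hθ' : (z.re - a) / (b - a) = 1 - θ := by
    rw [hθ]; field_simp; ring
  rw [hθ'] at h
  have h0 : 0 ≤ θ := div_nonneg (by linarith) hba.le
  have h1 : θ ≤ 1 := by rw [hθ, div_le_one hba]; linarith
  exact h.trans (rpow_mul_rpow_le_add (by positivity) hB.le h0 h1)

/-- From a finite-order bound in `‖s‖` to one in `|im s|` on a strip: for `R ≥ 0`, `B > 0` there
is `K` with `e^{‖s‖^B} ≤ K e^{|im s|^{B+1}}` whenever `|re s| ≤ R`. [folklore] -/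
theorem exists_exp_norm_rpow_le (R B : ℝ) (hR : 0 ≤ R) (hB : 0 < B) :
    ∃ K : ℝ, 0 < K ∧ ∀ s : ℂ, |s.re| ≤ R → Real.exp (‖s‖ ^ B) ≤ K * Real.exp (|s.im| ^ (B + 1)) := by
  set T₁ : ℝ := R + 2 ^ B + 1 with hT₁
  have h2B : (0 : ℝ) < 2 ^ B := by positivity
  refine ⟨Real.exp ((R + T₁) ^ B), Real.exp_pos _, fun s hs ↦ ?_⟩
  have hnorm : ‖s‖ ≤ R + |s.im| := (Complex.norm_le_abs_re_add_abs_im s).trans (by linarith)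
  have hK1 : 1 ≤ Real.exp ((R + T₁) ^ B) := Real.one_le_exp (by positivity)
  have hE1 : 1 ≤ Real.exp (|s.im| ^ (B + 1)) := Real.one_le_exp (by positivity)
  rcases le_or_gt |s.im| T₁ with ht | ht
  · have : ‖s‖ ^ B ≤ (R + T₁) ^ B :=
      Real.rpow_le_rpow (norm_nonneg _) (hnorm.trans (by linarith)) hB.le
    calc Real.exp (‖s‖ ^ B) ≤ Real.exp ((R + T₁) ^ B) := Real.exp_le_exp.2 this
      _ = Real.exp ((R + T₁) ^ B) * 1 := (mul_one _).symm
      _ ≤ Real.exp ((R + T₁) ^ B) * Real.exp (|s.im| ^ (B + 1)) := by gcongr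
  · have ht0 : 0 < |s.im| := by linarith
    have h1 : ‖s‖ ^ B ≤ |s.im| ^ (B + 1) := by
      calc ‖s‖ ^ B ≤ (2 * |s.im|) ^ B :=
            Real.rpow_le_rpow (norm_nonneg _) (hnorm.trans (by linarith)) hB.le
        _ = 2 ^ B * |s.im| ^ B := Real.mul_rpow (by norm_num) ht0.le
        _ ≤ |s.im| * |s.im| ^ B := by gcongr; linarith
        _ = |s.im| ^ (B + 1) := by rw [Real.rpow_add_one ht0.ne']; ring
    calc Real.exp (‖s‖ ^ B) ≤ Real.exp (|s.im| ^ (B + 1)) := Real.exp_le_exp.2 h1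
      _ = 1 * Real.exp (|s.im| ^ (B + 1)) := (one_mul _).symm
      _ ≤ Real.exp ((R + T₁) ^ B) * Real.exp (|s.im| ^ (B + 1)) := by gcongr

/-- Polynomial times exponential decay: for `K, p ≥ 0`, `a > 0` and `ε > 0` there is `T₀` with
`(K + |T|)^p e^{−a|T|} ≤ ε` for `|T| ≥ T₀`. [folklore] -/
theorem exists_rpow_mul_exp_neg_le {K p a : ℝ} (hK : 0 ≤ K) (hp : 0 ≤ p) (ha : 0 < a) {ε : ℝ}
    (hε : 0 < ε) : ∃ T₀ : ℝ, ∀ T : ℝ, T₀ ≤ |T| → (K + |T|) ^ p * Real.exp (-(a * |T|)) ≤ ε := by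
  set N : ℕ := ⌈p⌉₊ with hN
  -- for `|T| ≥ 1`: `(K+|T|)^p ≤ (K+1)^p |T|^N` and `|T|^N e^{-a|T|} ≤ (N+1)!/(a^{N+1} |T|)`
  set M : ℝ := (K + 1) ^ p * ((N + 1).factorial / a ^ (N + 1)) with hM
  have hM0 : 0 ≤ M := by positivity
  refine ⟨max 1 (M / ε), fun T hT ↦ ?_⟩
  have hT1 : 1 ≤ |T| := le_of_max_le_left hT
  have hT2 : M / ε ≤ |T| := le_of_max_le_right hT
  have hT0 : 0 < |T| := by linarith
  have h1 : (K + |T|) ^ p ≤ (K + 1) ^ p * |T| ^ (N : ℝ) := by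
    calc (K + |T|) ^ p ≤ ((K + 1) * |T|) ^ p :=
          Real.rpow_le_rpow (by positivity) (by nlinarith) hp
      _ = (K + 1) ^ p * |T| ^ p := Real.mul_rpow (by positivity) hT0.le
      _ ≤ (K + 1) ^ p * |T| ^ (N : ℝ) :=
          mul_le_mul_of_nonneg_left (Real.rpow_le_rpow_of_exponent_le hT1 (Nat.le_ceil p))
            (by positivity)
  have h2 : |T| ^ (N : ℝ) * Real.exp (-(a * |T|)) ≤ (N + 1).factorial / a ^ (N + 1) / |T| := by
    have hexp := Real.pow_div_factorial_le_exp (a * |T|) (by positivity) (N + 1)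
    rw [div_le_iff₀ (by positivity), mul_pow] at hexp
    rw [Real.rpow_natCast, le_div_iff₀ hT0, div_eq_mul_inv, Real.exp_neg]
    have hapos : 0 < a ^ (N + 1) := by positivity
    have hEpos : 0 < Real.exp (a * |T|) := Real.exp_pos _
    -- `|T|^N e^{-a|T|} |T| = (a|T|)^{N+1} e^{-a|T|} / a^{N+1} ≤ (N+1)!/a^{N+1}`
    calc |T| ^ N * (Real.exp (a * |T|))⁻¹ * |T|
        = (a ^ (N + 1) * |T| ^ (N + 1)) * (Real.exp (a * |T|))⁻¹ / a ^ (N + 1) := by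
          field_simp; ring
      _ ≤ (Real.exp (a * |T|) * (N + 1).factorial) * (Real.exp (a * |T|))⁻¹ / a ^ (N + 1) := by
          gcongr
      _ = (N + 1).factorial * (a ^ (N + 1))⁻¹ := by field_simp
  calc (K + |T|) ^ p * Real.exp (-(a * |T|))
      ≤ (K + 1) ^ p * |T| ^ (N : ℝ) * Real.exp (-(a * |T|)) := by gcongr
    _ = (K + 1) ^ p * (|T| ^ (N : ℝ) * Real.exp (-(a * |T|))) := by ring
    _ ≤ (K + 1) ^ p * ((N + 1).factorial / a ^ (N + 1) / |T|) := by gcongr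
    _ = M / |T| := by rw [hM]; ring
    _ ≤ ε := by
        rw [div_le_iff₀ hT0]
        rw [div_le_iff₀ hε] at hT2
        nlinarith

/-! ### The shift -/

/-- **Shifting the Mellin–Barnes line past the poles of `Γ`.** Let `Φ` be entire, `k ∈ ℕ`,
`w > 0`, and assume: `‖Φ(−k−1/2+it)‖ ≤ A₁ (K₁ + |t|)^α` (polynomial bound on the left line),
`‖Φ(3/2+it)‖ ≤ A₂` (bounded on the right line) and `‖Φ(s)‖ ≤ C e^{‖s‖^B}` on the closed strip
(finite order). Then both line integrals of `Φ(s) w^{−s} Γ(s)` converge absolutely and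

`(1/2π) ∫ (ΦΓw^{−s})(3/2+iy) dy − (1/2π) ∫ (ΦΓw^{−s})(−k−1/2+iy) dy = ∑_{j≤k} (−1)^j Φ(−j) wʲ/j!`,

the sum of the residues `Res_{s=−j} Φ(s)Γ(s)w^{−s} = (−1)^j Φ(−j) wʲ/j!` (Titchmarsh §2.7 for
`Φ = ζ`; Phragmén–Lindelöf makes the horizontal sides negligible). [folklore] -/
theorem mellinBarnes_shift_eq_sum {Φ : ℂ → ℂ} (hΦ : Differentiable ℂ Φ) (k : ℕ) {w : ℝ}
    (hw : 0 < w) {A₁ K₁ α A₂ C B : ℝ} (hA₁ : 0 < A₁) (hK₁ : 1 ≤ K₁) (hα : 0 ≤ α) (hA₂ : 0 < A₂)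
    (hB : 0 < B)
    (hleft : ∀ t : ℝ, ‖Φ (((-(k : ℝ) - 1 / 2 : ℝ) : ℂ) + t * I)‖ ≤ A₁ * (K₁ + |t|) ^ α)
    (hright : ∀ t : ℝ, ‖Φ (((3 / 2 : ℝ) : ℂ) + t * I)‖ ≤ A₂)
    (hfin : ∀ s : ℂ, -(k : ℝ) - 1 / 2 ≤ s.re → s.re ≤ 3 / 2 → ‖Φ s‖ ≤ C * Real.exp (‖s‖ ^ B)) :
    (Integrable fun y : ℝ ↦ Φ (((-(k : ℝ) - 1 / 2 : ℝ) : ℂ) + y * I) *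
        ((w : ℂ) ^ (-((((-(k : ℝ) - 1 / 2 : ℝ) : ℂ) + y * I))) *
          Complex.Gamma (((-(k : ℝ) - 1 / 2 : ℝ) : ℂ) + y * I))) ∧
    (1 / (2 * π) : ℂ) * (∫ y : ℝ, Φ (((3 / 2 : ℝ) : ℂ) + y * I) *
        ((w : ℂ) ^ (-((((3 / 2 : ℝ) : ℂ) + y * I))) * Complex.Gamma (((3 / 2 : ℝ) : ℂ) + y * I))) -
      (1 / (2 * π) : ℂ) * (∫ y : ℝ, Φ (((-(k : ℝ) - 1 / 2 : ℝ) : ℂ) + y * I) *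
        ((w : ℂ) ^ (-((((-(k : ℝ) - 1 / 2 : ℝ) : ℂ) + y * I))) *
          Complex.Gamma (((-(k : ℝ) - 1 / 2 : ℝ) : ℂ) + y * I))) =
      ∑ j ∈ Finset.range (k + 1),
        (-1) ^ j * Φ (-(j : ℂ)) * (w : ℂ) ^ (j : ℕ) / (j.factorial : ℂ) := by
  set a : ℝ := -(k : ℝ) - 1 / 2 with ha_def
  set c : ℝ := 3 / 2 with hc_def
  have hk0 : (0 : ℝ) ≤ k := k.cast_nonneg
  have hac : a < c := by rw [ha_def, hc_def]; linarith
  have hw0 : (w : ℂ) ≠ 0 := by exact_mod_cast hw.ne'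
  set F : ℂ → ℂ := fun z ↦ Φ z * ((w : ℂ) ^ (-z) * Complex.Gamma z) with hF_def
  -- poles and residues
  set S : Finset ℂ := (Finset.range (k + 1)).image fun j : ℕ ↦ (-(j : ℂ)) with hS_def
  set r : ℂ → ℂ := fun p ↦ Φ p * (w : ℂ) ^ (-p) *
    (Complex.Gamma (p + ((⌊-p.re⌋₊ + 1 : ℕ) : ℂ)) / ∏ i ∈ Finset.range ⌊-p.re⌋₊, (p + i))
    with hr_def
  set U : Set ℂ := {z | a - 1 / 4 < z.re} with hU_def
  have hU : IsOpen U := isOpen_lt continuous_const Complex.continuous_re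
  have hKU : re ⁻¹' Icc a c ⊆ U := fun z hz ↦ by
    simp only [hU_def, Set.mem_setOf_eq]; linarith [hz.1]
  have hmemS : ∀ {p : ℂ}, p ∈ S ↔ ∃ j : ℕ, j ≤ k ∧ p = -(j : ℂ) := by
    intro p
    simp only [hS_def, Finset.mem_image, Finset.mem_range, Nat.lt_succ_iff]
    constructor
    · rintro ⟨j, hj, rfl⟩; exact ⟨j, hj, rfl⟩
    · rintro ⟨j, hj, rfl⟩; exact ⟨j, hj, rfl⟩
  have hS : ∀ p ∈ S, p.re ∈ Ioo a c := by
    intro p hp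
    obtain ⟨j, hj, rfl⟩ := hmemS.1 hp
    have : (j : ℝ) ≤ k := by exact_mod_cast hj
    simp only [neg_re, natCast_re, Set.mem_Ioo, ha_def, hc_def]
    constructor <;> linarith
  -- `Γ` (hence `F`) is holomorphic on `U` away from `S`
  have hΓU : ∀ z ∈ U \ ↑S, DifferentiableAt ℂ Complex.Gamma z := by
    intro z hz
    refine Complex.differentiableAt_Gamma z fun m hm ↦ hz.2 ?_
    have hzU : a - 1 / 4 < z.re := hz.1
    rw [hm] at hzU ⊢
    simp only [neg_re, natCast_re, ha_def] at hzU
    have hmk : m ≤ k := by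
      by_contra h
      push Not at h
      have : (k : ℝ) + 1 ≤ m := by exact_mod_cast h
      linarith
    exact_mod_cast hmemS.2 ⟨m, hmk, rfl⟩
  have hF : DifferentiableOn ℂ F (U \ ↑S) := by
    intro z hz
    refine DifferentiableAt.differentiableWithinAt ?_
    simp only [hF_def]
    exact (hΦ z).mul ((differentiableAt_id.neg.const_cpow (Or.inl hw0)).mul (hΓU z hz))
  -- the simple poles
  have hpole : ∀ p ∈ S, ∃ φ : ℂ → ℂ, ∃ V ∈ 𝓝 p, DifferentiableOn ℂ φ V ∧ φ p = r p ∧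
      ∀ z ∈ V, z ≠ p → F z = φ z / (z - p) := by
    intro p hp
    obtain ⟨j, hj, rfl⟩ := hmemS.1 hp
    refine ⟨fun z ↦ Φ z * (w : ℂ) ^ (-z) *
      (Complex.Gamma (z + ((j + 1 : ℕ) : ℂ)) / ∏ i ∈ Finset.range j, (z + i)),
      Metric.ball (-(j : ℂ)) (1 / 2), Metric.ball_mem_nhds _ (by norm_num), ?_, ?_, ?_⟩
    · refine DifferentiableOn.mul ?_ (differentiableOn_Gamma_add_div_prod j)
      exact (hΦ.mul (differentiable_id.neg.const_cpow (Or.inl hw0))).differentiableOn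
    · have hfl : ⌊-(-(j : ℂ)).re⌋₊ = j := by simp
      simp only [hr_def, hfl]
    · intro z _ hzj
      simp only [hF_def]
      rw [Gamma_eq_div_div j z, sub_neg_eq_add]
      ring
  -- integrability on the right line
  have hΓc := integrable_Gamma_vertical (c := c) (by rw [hc_def]; norm_num) (by rw [hc_def]; norm_num)
  have hcontw : ∀ x : ℝ, Continuous fun y : ℝ ↦ (w : ℂ) ^ (-((x : ℂ) + y * I)) := fun x ↦
    Continuous.const_cpow (by fun_prop) (Or.inl hw0)
  have hcontΦ : ∀ x : ℝ, Continuous fun y : ℝ ↦ Φ ((x : ℂ) + y * I) := fun x ↦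
    hΦ.continuous.comp (by fun_prop)
  have hintc : Integrable fun y : ℝ ↦ F (c + y * I) := by
    have h := hΓc.bdd_mul ((hcontΦ c).mul (hcontw c)).aestronglyMeasurable
      (c := A₂ * w ^ (-c)) (Eventually.of_forall fun y ↦ ?_)
    · refine h.congr (Eventually.of_forall fun y ↦ ?_)
      simp only [hF_def, Pi.mul_apply]; ring
    · simp only [Pi.mul_apply]
      rw [norm_mul, Complex.norm_cpow_eq_rpow_re_of_pos hw]
      simp only [neg_re, add_re, ofReal_re, mul_re, I_re, mul_zero, ofReal_im, I_im, mul_one,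
        sub_self, add_zero]
      exact mul_le_mul_of_nonneg_right (hright y) (by positivity)
  -- `Γ` on the left line
  have hΓa : ∀ y : ℝ, ‖Complex.Gamma (a + y * I)‖ ≤
      Real.sqrt (2 * π) * 2 ^ (k + 1) / (k + 1).factorial * Real.exp (-(π * |y|) / 2) := by
    intro y
    have h1 := norm_Gamma_neg_half_sub_nat_le k y
    have h2 := factorial_mul_pow_le_prod_sqrt (le_refl (k + 1)) y
    rw [Nat.sub_self, pow_zero, mul_one] at h2
    have hP : 0 < ∏ j ∈ Finset.range (k + 1), Real.sqrt ((j + 1 / 2) ^ 2 + y ^ 2) :=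
      Finset.prod_pos fun j _ ↦ Real.sqrt_pos.2 (by positivity)
    have hf : (0 : ℝ) < (k + 1).factorial := by positivity
    rw [ha_def]
    refine h1.trans ?_
    rw [div_le_iff₀ hP]
    calc Real.sqrt (2 * π) * Real.exp (-(π * |y|) / 2)
        = Real.sqrt (2 * π) * 2 ^ (k + 1) / (k + 1).factorial * Real.exp (-(π * |y|) / 2) *
            ((k + 1).factorial / 2 ^ (k + 1)) := by field_simp
      _ ≤ _ := by gcongr
  have hcontΓa : Continuous fun y : ℝ ↦ Complex.Gamma (a + y * I) := by
    refine continuous_iff_continuousAt.2 fun y ↦ ?_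
    have hΓ : DifferentiableAt ℂ Complex.Gamma ((a : ℂ) + y * I) := by
      refine Complex.differentiableAt_Gamma _ fun m h ↦ ?_
      have h1 := congrArg Complex.re h
      simp only [add_re, ofReal_re, mul_re, I_re, mul_zero, ofReal_im, I_im, mul_one, sub_self,
        add_zero, neg_re, natCast_re, ha_def] at h1
      have h2 : (2 * m : ℕ) = 2 * k + 1 := by exact_mod_cast (by linarith : (2 * m : ℝ) = 2 * k + 1)
      omega
    exact ContinuousAt.comp (f := fun y : ℝ ↦ (a : ℂ) + y * I) hΓ.continuousAt (by fun_prop)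
  have hinta : Integrable fun y : ℝ ↦ F (a + y * I) := by
    have hpi : 0 < π / 2 := by positivity
    set M₀ : ℝ := A₁ * K₁ ^ α * w ^ (-a) * (Real.sqrt (2 * π) * 2 ^ (k + 1) / (k + 1).factorial)
      with hM₀
    have hdom := (integrable_one_add_abs_rpow_mul_exp_neg hpi hα).const_mul M₀
    refine hdom.mono' (((hcontΦ a).mul ((hcontw a).mul hcontΓa)).aestronglyMeasurable)
      (Eventually.of_forall fun y ↦ ?_)
    simp only [hF_def, norm_mul]
    rw [Complex.norm_cpow_eq_rpow_re_of_pos hw]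
    simp only [neg_re, add_re, ofReal_re, mul_re, I_re, mul_zero, ofReal_im, I_im, mul_one,
      sub_self, add_zero]
    have h1 : (K₁ + |y|) ^ α ≤ K₁ ^ α * (1 + |y|) ^ α := by
      rw [← Real.mul_rpow (by linarith) (by positivity)]
      exact Real.rpow_le_rpow (by positivity) (by nlinarith [abs_nonneg y]) hα
    have he : Real.exp (-(π * |y|) / 2) = Real.exp (-(π / 2 * |y|)) := by congr 1; ring
    calc ‖Φ (↑a + ↑y * I)‖ * (w ^ (-a) * ‖Complex.Gamma (↑a + ↑y * I)‖)
        ≤ (A₁ * (K₁ + |y|) ^ α) * (w ^ (-a) *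
          (Real.sqrt (2 * π) * 2 ^ (k + 1) / (k + 1).factorial * Real.exp (-(π * |y|) / 2))) := by
          gcongr
          · exact hleft y
          · exact hΓa y
      _ ≤ (A₁ * (K₁ ^ α * (1 + |y|) ^ α)) * (w ^ (-a) *
          (Real.sqrt (2 * π) * 2 ^ (k + 1) / (k + 1).factorial * Real.exp (-(π * |y|) / 2))) := by
          gcongr
      _ = M₀ * ((1 + |y|) ^ α * Real.exp (-(π / 2 * |y|))) := by rw [hM₀, he]; ring
  -- Phragmén–Lindelöf inside the strip
  set Q : ℝ := K₁ - a with hQ_def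
  have hQa : 0 < Q + a := by rw [hQ_def]; linarith
  obtain ⟨K, hK0, hK⟩ := exists_exp_norm_rpow_le (k + 2) B (by positivity) hB
  have hPL : ∀ z : ℂ, a ≤ z.re → z.re ≤ c → ‖Φ z‖ ≤ A₁ * 2 ^ α * ‖(Q : ℂ) + z‖ ^ α + A₂ := by
    intro z hza hzc
    refine norm_le_of_edge_bounds hΦ hac hQa (by positivity) hA₂ hα (by linarith : 0 < B + 1)
      (C := C * K) (fun z h1 h2 ↦ ?_) (fun z hz ↦ ?_) (fun z hz ↦ ?_) hza hzc
    · have hre : |z.re| ≤ k + 2 := by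
        rw [abs_le]; rw [ha_def] at h1; rw [hc_def] at h2; constructor <;> linarith
      calc ‖Φ z‖ ≤ C * Real.exp (‖z‖ ^ B) := hfin z (by rw [ha_def] at h1; exact h1.le) h2.le
        _ ≤ C * (K * Real.exp (|z.im| ^ (B + 1))) := by
            refine mul_le_mul_of_nonneg_left (hK z hre) ?_
            -- `C ≥ 0` since `‖Φ z‖ ≤ C e^{…}`
            have := hfin z (by rw [ha_def] at h1; exact h1.le) h2.le
            nlinarith [norm_nonneg (Φ z), Real.exp_pos (‖z‖ ^ B)]
        _ = C * K * Real.exp (|z.im| ^ (B + 1)) := by ring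
    · -- left edge: `K₁ + |t| ≤ 2 ‖Q + z‖`
      have hz' : z = (a : ℂ) + z.im * I := by
        apply Complex.ext <;> simp [hz]
      have h1 : ‖Φ z‖ ≤ A₁ * (K₁ + |z.im|) ^ α := by
        have := hleft z.im; rwa [← hz'] at this
      have h2 : K₁ + |z.im| ≤ 2 * ‖(Q : ℂ) + z‖ := by
        have hre : ((Q : ℂ) + z).re = K₁ := by simp [hz, hQ_def]
        have him : ((Q : ℂ) + z).im = z.im := by simp
        have hn1 : K₁ ≤ ‖(Q : ℂ) + z‖ := by
          have := Complex.abs_re_le_norm ((Q : ℂ) + z)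
          rwa [hre, abs_of_pos (by linarith)] at this
        have hn2 : |z.im| ≤ ‖(Q : ℂ) + z‖ := by
          have := Complex.abs_im_le_norm ((Q : ℂ) + z)
          rwa [him] at this
        linarith
      calc ‖Φ z‖ ≤ A₁ * (K₁ + |z.im|) ^ α := h1
        _ ≤ A₁ * (2 * ‖(Q : ℂ) + z‖) ^ α :=
            mul_le_mul_of_nonneg_left (Real.rpow_le_rpow (by positivity) h2 hα) hA₁.le
        _ = A₁ * (2 ^ α * ‖(Q : ℂ) + z‖ ^ α) := by
            rw [Real.mul_rpow (by norm_num) (norm_nonneg _)]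
        _ = A₁ * 2 ^ α * ‖(Q : ℂ) + z‖ ^ α := by ring
    · have hz' : z = (c : ℂ) + z.im * I := by
        apply Complex.ext <;> simp [hz]
      rw [hz']; exact hright z.im
  -- decay on horizontal segments
  have hdecay : ∀ ε : ℝ, 0 < ε → ∃ T₀ : ℝ, ∀ T : ℝ, T₀ ≤ |T| → ∀ x ∈ Icc a c,
      ‖F (x + T * I)‖ ≤ ε := by
    intro ε hε
    set W : ℝ := max (w ^ (-a)) (w ^ (-c)) with hW
    have hW0 : 0 < W := lt_max_of_lt_left (Real.rpow_pos_of_pos hw _)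
    have hwx : ∀ x ∈ Icc a c, w ^ (-x) ≤ W := by
      intro x hx
      rcases le_or_gt 1 w with h1 | h1
      · exact (Real.rpow_le_rpow_of_exponent_le h1 (by linarith [hx.1] : -x ≤ -a)).trans
          (le_max_left _ _)
      · exact (Real.rpow_le_rpow_of_exponent_ge hw h1.le (by linarith [hx.2] : -c ≤ -x)).trans
          (le_max_right _ _)
    set Kc : ℝ := Q + c with hKc
    have hKc1 : 1 ≤ Kc := by rw [hKc, hQ_def]; linarith
    set M₁ : ℝ := (A₁ * 2 ^ α + A₂) * W * (16 * π ^ 2) with hM₁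
    have hM₁0 : 0 < M₁ := by positivity
    obtain ⟨T₁, hT₁⟩ := exists_rpow_mul_exp_neg_le (K := Kc) (p := α + 3 / 2) (a := π / 2)
      (by linarith) (by linarith) (by positivity) (div_pos hε hM₁0)
    refine ⟨max 1 T₁, fun T hT x hx ↦ ?_⟩
    have hT1 : 1 ≤ |T| := le_of_max_le_left hT
    have hTT : T₁ ≤ |T| := le_of_max_le_right hT
    have hbase : 1 ≤ Kc + |T| := by linarith [abs_nonneg T]
    -- the three factors
    have hΦb : ‖Φ (x + T * I)‖ ≤ (A₁ * 2 ^ α + A₂) * (Kc + |T|) ^ α := by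
      have h1 := hPL (x + T * I) (by simpa using hx.1) (by simpa using hx.2)
      have h2 : ‖(Q : ℂ) + (x + T * I)‖ ≤ Kc + |T| := by
        refine (Complex.norm_le_abs_re_add_abs_im _).trans ?_
        have hre : ((Q : ℂ) + (x + T * I)).re = Q + x := by simp
        have him : ((Q : ℂ) + (x + T * I)).im = T := by simp
        rw [hre, him, abs_of_pos (by linarith [hx.1])]
        rw [hKc]; linarith [hx.2]
      have h3 : ‖(Q : ℂ) + (x + T * I)‖ ^ α ≤ (Kc + |T|) ^ α := Real.rpow_le_rpow (norm_nonneg _) h2 hα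
      have h4 : (1 : ℝ) ≤ (Kc + |T|) ^ α := Real.one_le_rpow hbase hα
      calc ‖Φ (x + T * I)‖ ≤ A₁ * 2 ^ α * ‖(Q : ℂ) + (x + T * I)‖ ^ α + A₂ := h1
        _ ≤ A₁ * 2 ^ α * (Kc + |T|) ^ α + A₂ * (Kc + |T|) ^ α := by
            gcongr; nlinarith
        _ = (A₁ * 2 ^ α + A₂) * (Kc + |T|) ^ α := by ring
    have hΓb : ‖Complex.Gamma (x + T * I)‖ ≤ 16 * π ^ 2 * (Kc + |T|) ^ (3 / 2 : ℝ) *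
        Real.exp (-(π * |T|) / 2) := by
      refine (norm_Gamma_le_of_re_le_two (by rw [hc_def] at hx; linarith [hx.2]) hT1).trans ?_
      exact mul_le_mul_of_nonneg_right (mul_le_mul_of_nonneg_left
        (Real.rpow_le_rpow (by positivity) (by linarith) (by norm_num)) (by positivity))
        (Real.exp_pos _).le
    have hwb : ‖(w : ℂ) ^ (-((x : ℂ) + T * I))‖ ≤ W := by
      rw [Complex.norm_cpow_eq_rpow_re_of_pos hw]
      simpa using hwx x hx
    have he : Real.exp (-(π * |T|) / 2) = Real.exp (-(π / 2 * |T|)) := by congr 1; ring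
    calc ‖F (x + T * I)‖ = ‖Φ (x + T * I)‖ * (‖(w : ℂ) ^ (-((x : ℂ) + T * I))‖ *
          ‖Complex.Gamma (x + T * I)‖) := by simp only [hF_def, norm_mul]
      _ ≤ ((A₁ * 2 ^ α + A₂) * (Kc + |T|) ^ α) * (W * (16 * π ^ 2 * (Kc + |T|) ^ (3 / 2 : ℝ) *
          Real.exp (-(π * |T|) / 2))) := by gcongr
      _ = M₁ * ((Kc + |T|) ^ (α + 3 / 2) * Real.exp (-(π / 2 * |T|))) := by
          rw [hM₁, he, Real.rpow_add (by linarith)]; ring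
      _ ≤ M₁ * (ε / M₁) := by gcongr; exact hT₁ T hTT
      _ = ε := by field_simp
  -- the residue theorem
  have hres := integral_vertical_sub_eq_sum_of_simplePoles hac S r U hU hKU hS hF hpole hinta hintc
    hdecay
  -- the residues
  have hsum : ∑ p ∈ S, r p =
      ∑ j ∈ Finset.range (k + 1), (-1) ^ j * Φ (-(j : ℂ)) * (w : ℂ) ^ (j : ℕ) / (j.factorial : ℂ) := by
    rw [hS_def, Finset.sum_image (fun j₁ _ j₂ _ h ↦ by exact_mod_cast neg_inj.1 h)]
    refine Finset.sum_congr rfl fun j _ ↦ ?_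
    have hfl : ⌊-(-(j : ℂ)).re⌋₊ = j := by simp
    simp only [hr_def, hfl]
    rw [Gamma_add_div_prod_neg_nat j, neg_neg, Complex.cpow_natCast]
    have hj : (j.factorial : ℂ) ≠ 0 := by exact_mod_cast j.factorial_ne_zero
    field_simp
  refine ⟨hinta, ?_⟩
  rw [← mul_sub]
  simp only [hF_def] at hres
  rw [hres, hsum]
  have hπ : (π : ℂ) ≠ 0 := by exact_mod_cast Real.pi_pos.ne'
  field_simp

end Literature.Analysis.Complex
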